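import Literature.Probability.Percolation.MedialGrid
import HarnessLib

/-!
# The trace of an interface loop: a union of corner cuts

Second groundwork file (after `MedialGrid`) for the lattice Jordan package of the
`dkkmo_rotation_invariance` bridge: the trace of a polyline is the union of its segments
(`range_polylineFrom_eq`, `range_polyline_cons`), hence the trace of the based loop
`loopCurve 1 0 γ` of a dart list `γ` (mesh `1`, no rotation) is the union of the segments between
consecutive medial points read cyclically (`range_loopCurve_one_zero`), and for an interface loop
each of these segments is the corner cut of the corresponding dart (`MedialGrid`); in particular
the trace lies on the medial grid and passes through every medial point of `γ`
(`medialPoint_mem_range_loopCurve`).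

## References

* G. Grimmett, *Percolation* (1999), §11.2; F. Camia, C. M. Newman, CMP 268 (2006), §2.
-/

noncomputable section

open Set

namespace Literature.Probability.Percolation

variable {E : Type*} [AddCommGroup E] [Module ℝ E] [TopologicalSpace E] [ContinuousAdd E]
  [ContinuousSMul ℝ E]

/-- **The trace of a polyline is the union of its segments** (and the starting point, which
matters only for the one-point polyline). [folklore] -/
theorem range_polylineFrom_eq (a : E) (l : List E) :
    Set.range (LatticeModels.polylineFrom a l).2 = {a} ∪ ⋃ p ∈ (a :: l).zip l, segment ℝ p.1 p.2 := by
  induction l generalizing a with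
  | nil =>
    simp only [LatticeModels.polylineFrom_nil, List.zip_nil_right, List.not_mem_nil, Set.iUnion_of_empty,
      Set.iUnion_empty, Set.union_empty]
    ext x
    simp only [Set.mem_range, Set.mem_singleton_iff]
    constructor
    · rintro ⟨t, rfl⟩; rfl
    · rintro rfl; exact ⟨0, rfl⟩
  | cons b l ih =>
    rw [LatticeModels.polylineFrom_cons]
    change Set.range ((Path.segment a b).trans (LatticeModels.polylineFrom b l).2) = _
    rw [Path.trans_range, Path.range_segment, ih b, List.zip_cons_cons]
    ext x
    simp only [Set.mem_union, Set.mem_singleton_iff, Set.mem_iUnion, List.mem_cons, exists_prop]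
    constructor
    · rintro (hx | hxb | ⟨p, hp, hx⟩)
      · exact Or.inr ⟨(a, b), Or.inl rfl, hx⟩
      · rw [hxb]; exact Or.inr ⟨(a, b), Or.inl rfl, right_mem_segment _ _ _⟩
      · exact Or.inr ⟨p, Or.inr hp, hx⟩
    · rintro (rfl | ⟨p, rfl | hp, hx⟩)
      · exact Or.inl (left_mem_segment _ _ _)
      · exact Or.inl hx
      · exact Or.inr (Or.inr ⟨p, hp, hx⟩)

/-- The trace of `polyline (a :: b :: l)` is the union of its segments. [folklore] -/
theorem range_polyline_cons_cons (a b : E) (l : List E) :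
    Set.range (LatticeModels.polyline (a :: b :: l)) = ⋃ p ∈ (a :: b :: l).zip (b :: l), segment ℝ p.1 p.2 := by
  change Set.range (LatticeModels.polylineFrom a (b :: l)).2 = _
  rw [range_polylineFrom_eq, Set.union_eq_right]
  intro x hx
  rw [Set.mem_singleton_iff] at hx
  rw [hx]
  simp only [List.zip_cons_cons, Set.mem_iUnion, List.mem_cons, exists_prop]
  exact ⟨(a, b), Or.inl rfl, left_mem_segment _ _ _⟩

end Literature.Probability.Percolation

namespace Literature.Probability.Percolation

open LatticeModels

/-- At mesh `1` and angle `0` the based loop of `γ` is the closed polyline through the medial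
points of `γ`. [folklore] -/
theorem loopCurve_one_zero (γ : List MedialVertex) :
    loopCurve 1 0 γ = RandomPlanarGeometry.CurveClass.mk ⟨polyline ((γ ++ γ.take 1).map (medialPoint 1))⟩ := by
  rw [loopCurve]
  congr 3
  refine List.map_congr_left fun e _ ↦ ?_
  simp [Circle.exp_zero]

/-- **The trace of the based loop of a dart list** (mesh `1`, angle `0`): the union, over the
cyclically consecutive pairs `γ.zip (γ.rotate 1)` (the darts), of the segments between their
medial points. [folklore] -/
theorem range_loopCurve_one_zero {γ : List MedialVertex} (hγ : γ ≠ []) :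
    (loopCurve 1 0 γ).range = ⋃ q ∈ γ.zip (γ.rotate 1), segment ℝ (medialPoint 1 q.1) (medialPoint 1 q.2) := by
  obtain ⟨a, rest, rfl⟩ := List.exists_cons_of_ne_nil hγ
  rw [loopCurve_one_zero, RandomPlanarGeometry.CurveClass.range_mk, List.rotate_cons_succ, List.rotate_zero]
  change Set.range (polyline (List.map (medialPoint 1) (a :: rest ++ [a]))) = _
  cases rest with
  | nil =>
    -- one dart `(a, a)`: both sides are the point `medialPoint 1 a`
    have h1 : Set.range (polyline (List.map (medialPoint 1) ([a] ++ [a]))) = {medialPoint 1 a} := by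
      change Set.range (polylineFrom (medialPoint 1 a) [medialPoint 1 a]).2 = _
      rw [range_polylineFrom_eq]
      simp [segment_same]
    rw [h1]
    simp [segment_same]
  | cons b l =>
    rw [List.cons_append, List.cons_append, List.map_cons, List.map_cons, List.map_append,
      List.map_singleton, range_polyline_cons_cons]
    -- the zipped vertex lists are the mapped darts
    have hzip : (medialPoint 1 a :: medialPoint 1 b :: (List.map (medialPoint 1) l ++ [medialPoint 1 a])).zip
        (medialPoint 1 b :: (List.map (medialPoint 1) l ++ [medialPoint 1 a])) =
        ((a :: b :: l).zip (b :: l ++ [a])).map (Prod.map (medialPoint 1) (medialPoint 1)) := by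
      have e1 : (medialPoint 1 a :: medialPoint 1 b :: (List.map (medialPoint 1) l ++ [medialPoint 1 a])) =
          List.map (medialPoint 1) ((a :: b :: l) ++ [a]) := by simp
      have e2 : (medialPoint 1 b :: (List.map (medialPoint 1) l ++ [medialPoint 1 a])) =
          List.map (medialPoint 1) ((b :: l ++ [a]) ++ []) := by simp
      rw [e1, e2, List.zip_map, List.zip_append (by simp)]
      simp
    rw [hzip]
    ext x
    simp only [Set.mem_iUnion, List.mem_map, exists_prop]
    constructor
    · rintro ⟨p, ⟨⟨e, e'⟩, he, rfl⟩, hx⟩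
      exact ⟨(e, e'), he, hx⟩
    · rintro ⟨⟨e, e'⟩, hq, hx⟩
      exact ⟨(medialPoint 1 e, medialPoint 1 e'), ⟨(e, e'), hq, rfl⟩, hx⟩

/-- The darts of an interface loop: the cyclically consecutive pairs are medial darts. [folklore] -/
theorem IsInterfaceLoop.isMedialDart_of_mem_zip {ω : BondConfig (Site 2)}
    {γ : List MedialVertex} (h : IsInterfaceLoop ω γ) {e e' : MedialVertex}
    (hq : (e, e') ∈ γ.zip (γ.rotate 1)) : IsMedialDart e e' := by
  obtain ⟨i, hi, heq⟩ := List.mem_iff_getElem.1 hq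
  have hi' : i < γ.length := by simpa using hi
  simp only [List.getElem_zip, List.getElem_rotate, Prod.mk.injEq] at heq
  obtain ⟨rfl, rfl⟩ := heq
  have := h.isMedialDart i hi'
  convert this using 2

/-- **The trace of an interface loop is a union of corner cuts**: every point of the trace lies on
the corner cut of some dart of the loop. [folklore] -/
theorem exists_cornerCut_of_mem_range_loopCurve {ω : BondConfig (Site 2)} {γ : List MedialVertex}
    (h : IsInterfaceLoop ω γ) {x : ℂ} (hx : x ∈ (loopCurve 1 0 γ).range) :
    ∃ q ∈ γ.zip (γ.rotate 1), ∃ v f : Site 2, IsCorner v f ∧ cornerSource v f = q.1 ∧ cornerTarget v f = q.2 ∧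
      x ∈ cornerCut v f := by
  rw [range_loopCurve_one_zero h.ne_nil] at hx
  simp only [Set.mem_iUnion, exists_prop] at hx
  obtain ⟨⟨e, e'⟩, hq, hx⟩ := hx
  obtain ⟨v, f, hv, hs, ht, hseg⟩ := (h.isMedialDart_of_mem_zip hq).exists_segment_eq_cornerCut
  exact ⟨(e, e'), hq, v, f, hv, hs, ht, hseg ▸ hx⟩

/-- Every medial point of the dart list lies on the trace of its based loop. [folklore] -/
theorem medialPoint_mem_range_loopCurve (γ : List MedialVertex) {e : MedialVertex} (he : e ∈ γ) :
    medialPoint 1 e ∈ (loopCurve 1 0 γ).range := by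
  rw [loopCurve_one_zero, RandomPlanarGeometry.CurveClass.range_mk]
  exact mem_range_polyline (List.mem_map_of_mem (List.mem_append_left _ he))

end Literature.Probability.Percolation

end
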